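import Summits.AtomisticToContinuum.FouriersLaw.Theses.OddSectorIrreversibility
import Summits.AtomisticToContinuum.FouriersLaw.Theorems.BoundaryKubo.Negative.Reflection

/-!
# `BoundedResponseConverges` / Negative: the two-sided response limit is not load-bearing

Negative knowledge for crux `stmt-AtomisticToContinuum-9141`
(`OddSectorIrreversibility.BoundedResponseConverges`), crux disprover, cycle 2 (2026-08-16), from the
sibling crux's landed reflection symmetry (`Theorems/BoundaryKubo/Negative/Reflection.lean`: under
weak-NESS uniqueness the steady current of `pinnedChain` is antisymmetric under `T_L ↔ T_R`).

* `boundedResponseConverges_noCurrent_of_unique` — along ANY steady family, under uniqueness, the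
  steady current vanishes at equal bath temperatures (no appeal to the Gibbs state): the crux's response
  quotient is a genuine difference quotient at `δ = 0`.
* `boundedResponseConverges_iff_oneSided` — the crux is EQUIVALENT to its version with ONE-SIDED
  response coefficients (`𝓝[>] 0`: hot bath on the left only). Provers may take `δ > 0`; a disprover
  gains nothing from the sign of `δ`.
Nothing here closes an item.
-/

noncomputable section

namespace Summit.AtomisticToContinuum.FouriersLaw.Theorems

open MeasureTheory Filter Topology
open Literature.MathematicalPhysics.KineticTheory.HeatConduction
open Summit.AtomisticToContinuum.FouriersLaw.Theses.OddSectorIrreversibility (BoundedResponseConverges)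
open Summit.AtomisticToContinuum.FouriersLaw.Theorems.BoundaryKubo.Negative.Reflection
  (totalCurrent_antisymm tendsto_responseQuotient_iff)

/-- **No steady current at equal bath temperatures**, along any steady family of `pinnedChain ω₂ lam β γ`
under weak-NESS uniqueness (reflection antisymmetry `J(b,a) = -J(a,b)` at `a = b`). [folklore] -/
theorem boundedResponseConverges_noCurrent_of_unique {ω₂ lam β γ : ℝ}
    (hu : ∀ (N : ℕ) (T_L T_R : ℝ), 0 < T_L → 0 < T_R → ∀ μ' ν' : Measure (PhaseSpace N),
      (pinnedChain ω₂ lam β γ).IsSteadyState N T_L T_R μ' →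
        (pinnedChain ω₂ lam β γ).IsSteadyState N T_L T_R ν' → μ' = ν')
    {μ : (N : ℕ) → ℝ → ℝ → Measure (PhaseSpace N)}
    (hμ : ∀ (N : ℕ) (T_L T_R : ℝ), 0 < T_L → 0 < T_R →
      (pinnedChain ω₂ lam β γ).IsSteadyState N T_L T_R (μ N T_L T_R))
    {T : ℝ} (hT : 0 < T) (N : ℕ) :
    (pinnedChain ω₂ lam β γ).totalCurrent (μ N T T) = 0 := by
  have h := totalCurrent_antisymm hu hμ hT hT N
  linarith

/-- **The crux is equivalent to its one-sided version** (`𝓝[>] 0` in place of `𝓝[≠] 0` in the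
response hypothesis), under its own uniqueness antecedent, by the evenness of the response quotient
(`tendsto_responseQuotient_iff`). [folklore] -/
theorem boundedResponseConverges_iff_oneSided :
    BoundedResponseConverges ↔
      ∀ ω₂ lam β γ : ℝ, 0 < ω₂ → 0 < lam → 0 < β → 0 < γ →
        (∀ (N : ℕ) (T_L T_R : ℝ), 0 < T_L → 0 < T_R → ∀ μ ν : Measure (PhaseSpace N),
          (pinnedChain ω₂ lam β γ).IsSteadyState N T_L T_R μ →
            (pinnedChain ω₂ lam β γ).IsSteadyState N T_L T_R ν → μ = ν) →
        ∀ μ : (N : ℕ) → ℝ → ℝ → Measure (PhaseSpace N),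
          (∀ (N : ℕ) (T_L T_R : ℝ), 0 < T_L → 0 < T_R →
            (pinnedChain ω₂ lam β γ).IsSteadyState N T_L T_R (μ N T_L T_R)) →
          ∀ T : ℝ, 0 < T → ∀ D : ℕ → ℝ,
            (∀ N : ℕ, Tendsto (fun δ : ℝ =>
                (pinnedChain ω₂ lam β γ).totalCurrent (μ N (T + δ / 2) (T - δ / 2)) / δ)
              (𝓝[>] 0) (𝓝 (D N))) →
            BddAbove (Set.range fun N => |D N|) → ∃ k : ℝ, 0 < k ∧ Tendsto D atTop (𝓝 k) := by
  constructor
  · intro h ω₂ lam β γ hω hl hβ hγ hu μ hμ T hT D hD hB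
    exact h ω₂ lam β γ hω hl hβ hγ hu μ hμ T hT D
      (fun N => (tendsto_responseQuotient_iff hu hμ hT N (D N)).2 (hD N)) hB
  · intro h ω₂ lam β γ hω hl hβ hγ hu μ hμ T hT D hD hB
    exact h ω₂ lam β γ hω hl hβ hγ hu μ hμ T hT D
      (fun N => (tendsto_responseQuotient_iff hu hμ hT N (D N)).1 (hD N)) hB

end Summit.AtomisticToContinuum.FouriersLaw.Theorems

end
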